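import Summits.BirchSwinnertonDyer.BirchSwinnertonDyer.Theorems.TameQuarticSolventSolventPairLowerBoundSolventFieldReal
import Summits.BirchSwinnertonDyer.Rank1Residual.Additive.QuadraticTwistBSDComparison
import Literature.NumberTheory.EllipticCurves.ArtinMilneShaDecomposition
import Literature.NumberTheory.EllipticCurves.Disegni2020.PAdicBSDRankOneMultiplicativeProofs
import Literature.NumberTheory.EllipticCurves.LeadingTermPPartProofs
import Literature.NumberTheory.EllipticCurves.AnalyticRankModularityProofs
import HarnessLib

/-!
# Route `TameQuarticSolvent`, crux `SolventPairLowerBound` (stmt-BirchSwinnertonDyer-21391), line `birth` —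
# stub `stub_pairGivenGoodField` REDUCED to its two non-published inputs K1 (exact `BSD₃` of `E` over the
# totally real tame quartic) and K2a (a Kolyvagin UPPER bound for the `χ_β`-component over `ℚ(√d)`)

HONEST FRAMING. Theorems only; helper file (`--supports stmt-BirchSwinnertonDyer-21391`). The registered
stub `stub_pairGivenGoodField` of the birth skeleton (`Cruxes/SolventPairLowerBound/Lines/birth.lean`) is
NOT proved. This file is the kernel-checked BOOKKEEPING «`stub_pairGivenGoodField ⇐ K1 ∧ K2a ∧ published
inputs`» asked for by the lead's decomposition (evidence DECOMPOSITION-21391.md, «PairGivenGoodField ⇐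
SolventField · ExactBSD3OverSolvent · KolyvaginTwistedUpper · bookkeeping»): the field-theoretic part
(«SolventField») is PROVED in the companion files `…SolventField.lean` / `…SolventFieldReal.lean`, the
bookkeeping is the tree's Artin–Milne decomposition
`Literature.NumberTheory.EllipticCurves.padicValRat_shaAn_add_le_shaOrder_of_bsdpOver` (D2), and what is
genuinely OPEN is displayed as the two explicit hypotheses `K1`, `K2a` of `stub_pairGivenGoodField_of`,
written as closed `Prop` terms in the tree's currencies (`BSDpOver`, `analyticSha`, `HasEntireLFunction`,
`NumberField.IsTotallyReal`, `Ideal.ramificationIdx`) so that the planner can file them verbatim. The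
published inputs are the tree's NAMED FACTS, taken by name: Dokchitser–Dokchitser 2010 Thm. 2.3 (`p`-part)
in Milne's restriction-of-scalars form (`Milne1972.bsdQuotientP_baseChange_relQuadratic_anyModel`),
modularity (`exists_isNewformOf`, `nonempty_modularParametrizationData`), Gross–Zagier 1986 Thm. I.(7.3)
(`GrossZagier1986_thm_I_7_3`) and Gross–Zagier–Kolyvagin (`rank_eq_analyticRank_of_analyticRank_le_one`).
BSD is not proved by any of this; no route file is imported.

WHAT.
* `exists_heightOneSpectrum_natCast_mem` — a number field has a finite place above every prime `p`.
* `exists_rat_shaAn_eq_of_analyticRank_eq_zero` — `#Ш_an(E) ∈ ℚ` in analytic rank `0` (modular symbols: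
  `L(E,1) = [0]⁺ Ω⁺_f`, `Ω⁺_f = ϖ Ω_E`, `Reg = 1` by GZK).
* `stub_pairGivenGoodField_of` — GIVEN the five named facts and `K1`, `K2a` below, the body of the
  registered stub `stub_pairGivenGoodField` holds. Proof: `K = ℚ(√d)` (`exists_quadraticField_sq_eq_intCast`;
  `3` ramifies, `√d` a uniformiser, `ramificationIdx_eq_two_of_sq_eq_intCast`); K2a supplies a totally positive
  `β ∈ K` of odd valuation above `3` together with a `K`-model `Vβ` of `E_K^{(β)}` carrying an entire
  `L`-function, a rational `#Ш_an` and the upper bound `ord₃ #Ш(Vβ)[3^∞] ≤ ord₃ #Ш_an(Vβ)`; `M = K(√β)`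
  (`exists_relQuadratic_sq_eq`) is then totally real (`isTotallyReal_of_sq_eq_of_totallyPositive`) with
  `e(w|3) = 4` at every `w ∣ 3` (`ramificationIdx_int_eq_of_sq_eq`), so the stub's good-reduction hypothesis
  applies over `M` and K1 gives `BSD₃(E_M/M)`; the twist datum `(d, Wd)` is a model of `E^{(d_K)}`
  (`exists_variableChange_quadraticTwist_discr`); D2's one-sided squeeze concludes.

THE TWO OPEN INPUTS (hypotheses, displayed — for the planner's split of 21391):
* `K1` («ExactBSD3OverSolventQuartic»): for `W/ℚ` on the leaf (non-CM, (t′) at `3`, `r_an = 1`) and number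
  fields `K ⊂ M` with `[K : ℚ] = [M : K] = 2`, `M` totally real, every place `w ∣ 3` of `M` of ramification
  index `4` and of good reduction for `W_M`: `BSDpOver (W.baseChange M) 3` (the `3`-part of the
  Birch–Swinnerton-Dyer formula for `E` over `M`, Dokchitser–Dokchitser / Miller currency).
* `K2a` («KolyvaginTwistedUpperOverK»): for such `W`, `d > 0` with `ord₃ d = 1`, and `K = ℚ(θ₁)`, `θ₁² = d`,
  `[K : ℚ] = 2`: there is `β ∈ K`, of ODD valuation at every place of `K` above `3` and totally positive,
  and a `K`-model `Vβ ≅ (W_K)^{(β)}` with `L(Vβ/K, s)` entire, `Ш(Vβ/K)[3^∞]` finite, `#Ш_an(Vβ/K) = qβ ∈ ℚ`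
  and `ord₃ #Ш(Vβ/K)[3^∞] ≤ ord₃ qβ` (Friedberg–Hoffstein over `K` with prescribed local behaviour at `3`
  and `∞`, Kolyvagin's Euler-system bound for `E_K ⊗ χ_β`, Zhang's Gross–Zagier formula over `K`).

References: T. Dokchitser, V. Dokchitser, Ann. of Math. 172 (2010) Thm. 2.3; J. S. Milne, Invent. Math. 17
(1972) Thm. 1; B. Gross, D. Zagier, Invent. Math. 84 (1986) Thm. I.(7.3); V. A. Kolyvagin, *Euler systems*
(1990); R. L. Miller, LMS J. Comput. Math. 14 (2011) §1; B. Mazur, J. Tate, J. Teitelbaum, Invent. Math. 84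
(1986) §I.8.
-/

-- D-0017: single-problem summit, so `Summit.BirchSwinnertonDyer.BirchSwinnertonDyer.…` repeats a namespace BY DESIGN.
set_option linter.dupNamespace false

noncomputable section

open scoped NumberField

open IsDedekindDomain IsDedekindDomain.HeightOneSpectrum NumberField WithZero WeierstrassCurve
  Literature.NumberTheory.EllipticCurves Literature.NumberTheory.EllipticCurves.ModularForms
  Literature.NumberTheory.EllipticCurves.Rank1Residual Summit.BirchSwinnertonDyer.Rank1Residual.Additive

namespace Summit.BirchSwinnertonDyer.BirchSwinnertonDyer.Theorems.SolventPairLowerBound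

/-! ## Two small inputs -/

/-- A number field has a finite place above every rational prime `p` (`p` is not a unit of `𝓞 K`;
going-up for the integral extension `ℤ ⊂ 𝓞 K`). [folklore] -/
theorem exists_heightOneSpectrum_natCast_mem (K : Type) [Field K] [NumberField K] (p : ℕ)
    [hp : Fact p.Prime] : ∃ v : HeightOneSpectrum (𝓞 K), (p : 𝓞 K) ∈ v.asIdeal := by
  have hpZ : (p : ℤ) ≠ 0 := Int.natCast_ne_zero.mpr hp.out.ne_zero
  haveI hmax : (Ideal.span {(p : ℤ)}).IsMaximal :=
    ((Ideal.span_singleton_prime hpZ).mpr (Nat.prime_iff_prime_int.mp hp.out)).isMaximal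
      (by simpa using hpZ)
  obtain ⟨𝔪, h𝔪, hover⟩ := Ideal.exists_ideal_over_maximal_of_isIntegral (S := 𝓞 K)
    (Ideal.span {(p : ℤ)}) (fun x hx ↦ by
      rw [RingHom.mem_ker, eq_intCast, Int.cast_eq_zero] at hx
      simp [hx])
  have hp𝔪 : (p : 𝓞 K) ∈ 𝔪 := by
    have : (p : ℤ) ∈ 𝔪.comap (algebraMap ℤ (𝓞 K)) := by
      rw [hover]; exact Ideal.mem_span_singleton_self _
    simpa [Ideal.mem_comap] using this
  have h𝔪0 : 𝔪 ≠ ⊥ := by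
    intro h; rw [h, Ideal.mem_bot] at hp𝔪; exact (NeZero.ne (p : 𝓞 K)) hp𝔪
  exact ⟨⟨𝔪, h𝔪.isPrime, h𝔪0⟩, hp𝔪⟩

/-- **`#Ш_an(E) ∈ ℚ` in analytic rank `0`.** For a globally minimal `W/ℚ` with `r_an = 0`:
`L(W,1) = [0]⁺_f · Ω⁺_f` (modular symbols, `IsNewformOf.entireLFunction_one_eq`) and `Ω⁺_f = ϖ · Ω(W)` with
`ϖ ∈ ℚ` (`ModularParametrizationData.exists_rat_mul_realPeriodRat_eq_plusPeriod`), so `L(W,1) = s Ω(W)`,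
`s ∈ ℚ`, and `#Ш_an = s · #tors² / ∏ c` (`TwistComparison.shaAn_eq_ratCast_of_rankZero`, `Reg = 1` by GZK).
[cite: MazurTateTeitelbaum1986Invent, §I.8 (8.6)] [cite: Miller2011LMS, §1 (arXiv:1010.2431 p. 3)] -/
theorem exists_rat_shaAn_eq_of_analyticRank_eq_zero (hmodP : nonempty_modularParametrizationData)
    (hGZK : rank_eq_analyticRank_of_analyticRank_le_one)
    (W : WeierstrassCurve ℚ) [W.IsElliptic] [W.IsGloballyMinimal] (hr : W.analyticRank = 0) :
    ∃ q : ℚ, shaAn W = (q : ℂ) := by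
  haveI : NeZero (W.conductorNorm ℤ) := ⟨(W.conductorNorm_pos_holds).ne'⟩
  obtain ⟨Dm⟩ := hmodP W
  have hf : IsNewformOf W Dm.f := Dm.isNewformOf
  obtain ⟨ϖ, -, hϖeq, -⟩ := Dm.exists_rat_mul_realPeriodRat_eq_plusPeriod
  have hs : W.entireLFunction 1 =
      ((ratPlusSymbol Dm.f 0 * ϖ : ℚ) : ℂ) * (W.realPeriodRat : ℂ) := by
    rw [hf.entireLFunction_one_eq, ← hϖeq]
    push_cast
    ring
  exact ⟨_, TwistComparison.shaAn_eq_ratCast_of_rankZero (W := W) hGZK hr hs⟩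

/-! ## The reduction of `stub_pairGivenGoodField` to K1 and K2a -/

/-- **`stub_pairGivenGoodField` from K1, K2a and published inputs.** GIVEN the named facts
Dokchitser–Dokchitser 2010 Thm. 2.3 (`p`-part, Milne's form: `hDD`), modularity (`hmod`, `hmodP`),
Gross–Zagier Thm. I.(7.3) (`hGZ`) and Gross–Zagier–Kolyvagin (`hGZK`), and the two OPEN inputs displayed
in the module docstring — `K1`: exact `BSD₃` for `E` over every totally real quartic `M = K(√β) ⊃ K`
(`[K:ℚ] = [M:K] = 2`) with `e(w|3) = 4` and good reduction at every `w ∣ 3`; `K2a`: over `K = ℚ(√d)` a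
totally positive `β` of odd valuation above `3` with a `K`-model of `E_K^{(β)}` having entire `L`-function,
rational `#Ш_an` and the Kolyvagin upper bound at `3` — the body of the registered stub
`stub_pairGivenGoodField` holds: for `W` on the leaf satisfying the lever's conclusion and any admissible
twist datum `(d, Wd)`, `ord₃ #Ш_an(W) + ord₃ #Ш_an(Wd) ≤ ord₃ #Ш(W) + ord₃ #Ш(Wd)`. The squeeze itself is
the tree's `padicValRat_shaAn_add_le_shaOrder_of_bsdpOver` over the tower `ℚ ⊂ K ⊂ M`.
[cite: DokchitserDokchitserAnnals2010, §2.1 Thm. 2.3 (second clause) and its proof]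
[cite: Milne1972ArithmeticAV, §1 Thm. 1] [cite: GrossZagier1986, Thm. I.(7.3)]
[cite: Miller2011LMS, §1 and Def. 1.1 (arXiv:1010.2431 p. 3)] -/
theorem stub_pairGivenGoodField_of
    (hDD : Milne1972.bsdQuotientP_baseChange_relQuadratic_anyModel)
    (hmod : exists_isNewformOf) (hmodP : nonempty_modularParametrizationData)
    (hGZ : GrossZagier1986_thm_I_7_3) (hGZK : rank_eq_analyticRank_of_analyticRank_le_one)
    (K1 : ∀ (W : WeierstrassCurve ℚ) [W.IsElliptic] [W.IsGloballyMinimal],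
      ¬ W.HasCM → Addv W 3 → Summit.BirchSwinnertonDyer.Rank1Residual.Additive.SubTprime W 3 →
      W.analyticRank = 1 →
      ∀ (K : Type) [Field K] [NumberField K] (M : Type) [Field M] [NumberField M] [Algebra K M],
        Module.finrank ℚ K = 2 → Module.finrank K M = 2 → IsTotallyReal M →
        (∀ w : HeightOneSpectrum (𝓞 M), ((3 : ℕ) : 𝓞 M) ∈ w.asIdeal →
          w.asIdeal.ramificationIdx ℤ = 4) →
        (∀ w : HeightOneSpectrum (𝓞 M), ((3 : ℕ) : 𝓞 M) ∈ w.asIdeal →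
          (W.baseChange M).HasGoodReductionAt w) →
        BSDpOver (W.baseChange M) 3)
    (K2a : ∀ (W : WeierstrassCurve ℚ) [W.IsElliptic] [W.IsGloballyMinimal],
      ¬ W.HasCM → Addv W 3 → Summit.BirchSwinnertonDyer.Rank1Residual.Additive.SubTprime W 3 →
      W.analyticRank = 1 →
      ∀ (d : ℤ), 0 < d → padicValInt 3 d = 1 →
      ∀ (K : Type) [Field K] [NumberField K] (θ₁ : K), Module.finrank ℚ K = 2 → θ₁ ^ 2 = (d : K) →
        ∃ β : K,
          (∀ v : HeightOneSpectrum (𝓞 K), ((3 : ℕ) : 𝓞 K) ∈ v.asIdeal →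
            ∃ k : ℤ, v.valuation K β = WithZero.exp (2 * k + 1)) ∧
          (∀ σ : K →+* ℝ, 0 < σ β) ∧
          ∃ (Vβ : WeierstrassCurve K) (_ : Vβ.IsElliptic),
            (∃ C : WeierstrassCurve.VariableChange K, C • (W.baseChange K).quadraticTwist β = Vβ) ∧
            Vβ.HasEntireLFunction ∧
            Finite (AddCommGroup.primaryComponent Vβ.sha 3) ∧
            ∃ qβ : ℚ, analyticSha Vβ = (qβ : ℂ) ∧
              (padicValNat 3 (Nat.card (AddCommGroup.primaryComponent Vβ.sha 3)) : ℤ) ≤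
                padicValRat 3 qβ) :
    ∀ (W : WeierstrassCurve ℚ) [W.IsElliptic] [W.IsGloballyMinimal],
    ¬ W.HasCM → Addv W 3 → Summit.BirchSwinnertonDyer.Rank1Residual.Additive.SubTprime W 3 →
      W.analyticRank = 1 →
    (∀ (L : Type) [Field L] [NumberField L] (v : HeightOneSpectrum (𝓞 L)),
      ((3 : ℕ) : 𝓞 L) ∈ v.asIdeal → v.asIdeal.ramificationIdx ℤ = 4 →
      (W.baseChange L).HasGoodReductionAt v) →
    ∀ (d : ℤ) (Wd : WeierstrassCurve ℚ) [Wd.IsElliptic] [Wd.IsGloballyMinimal],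
      0 < d → padicValInt 3 d = 1 →
      (∃ C : WeierstrassCurve.VariableChange ℚ, C • W.quadraticTwist (d : ℚ) = Wd) →
      ¬ Wd.HasCM → Addv Wd 3 → Summit.BirchSwinnertonDyer.Rank1Residual.Additive.SubTprime Wd 3 →
      Wd.analyticRank = 0 →
      ∃ q q' : ℚ, shaAn W = (q : ℂ) ∧ shaAn Wd = (q' : ℂ) ∧
        padicValRat 3 q + padicValRat 3 q' ≤
          (padicValNat 3 W.shaOrder : ℤ) + (padicValNat 3 Wd.shaOrder : ℤ) := by
  intro W _ _ hCM hadd hsub hr hgood d Wd _ _ hd0 hd hWd _hCMd _haddd _hsubd hr0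
  -- published inputs over `ℚ`
  have hE : hasEntireLFunction_rat := WeierstrassCurve.hasEntireLFunction_rat_of_exists_isNewformOf hmod
  have hAM : ArtinMilneShaDecomposition := artinMilneShaDecomposition_of_relQuadratic hDD
  obtain ⟨qW, hqW⟩ := Disegni2020.exists_rat_shaAn_eq_of_analyticRank_eq_one hGZ hGZK W hr
  obtain ⟨qWd, hqWd⟩ := exists_rat_shaAn_eq_of_analyticRank_eq_zero hmodP hGZK Wd hr0
  have hWfin : W.ShaFinite := (hGZK W (by omega)).2
  have hWdfin : Wd.ShaFinite := (hGZK Wd (by omega)).2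
  -- the real quadratic field `K = ℚ(√d)`
  obtain ⟨K, _, _, θ₁, h2, hθ₁, hθK⟩ :=
    exists_quadraticField_sq_eq_intCast (not_isSquare_ratCast_of_padicValInt_eq_one 3 hd)
  have hWd' := exists_variableChange_quadraticTwist_discr h2 hθ₁ hθK W Wd hWd
  -- K2a: the element `β` and the twisted model over `K`
  obtain ⟨β, hval, hpos, Vβ, _, hVβ, hVβL, hβfin, qβ, hqβ, hβup⟩ :=
    K2a W hCM hadd hsub hr d hd0 hd K θ₁ h2 hθ₁
  -- `β` is not a square (odd valuation at a place above `3`), so `M = K(√β)` is a quadratic extension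
  obtain ⟨v₀, hv₀⟩ := exists_heightOneSpectrum_natCast_mem K 3
  obtain ⟨k₀, hk₀⟩ := hval v₀ hv₀
  obtain ⟨M, _, _, _, θ, h2', hθ, hθM⟩ := exists_relQuadratic_sq_eq (not_isSquare_of_valuation_eq_exp v₀ hk₀)
  -- properties of `M`: `e(w|3) = 4`, good reduction above `3`, totally real
  have he : ∀ w : HeightOneSpectrum (𝓞 M), ((3 : ℕ) : 𝓞 M) ∈ w.asIdeal →
      w.asIdeal.ramificationIdx ℤ = 4 := fun w hw ↦ by
    have h := ramificationIdx_int_eq_of_sq_eq (K := K) (M := M) 3 h2' hθ (e₀ := 2)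
      (fun v hv ↦ ⟨(ramificationIdx_eq_two_of_sq_eq_intCast 3 h2 hθ₁ hd v hv).1, hval v hv⟩) w hw
    simpa using h
  have hgoodM : ∀ w : HeightOneSpectrum (𝓞 M), ((3 : ℕ) : 𝓞 M) ∈ w.asIdeal →
      (W.baseChange M).HasGoodReductionAt w := fun w hw ↦ hgood M w hw (he w hw)
  have hTR : IsTotallyReal M :=
    isTotallyReal_of_sq_eq_of_totallyPositive h2 hd0.le hθ₁ hθK h2' hθ hθM hpos
  -- K1: exact `BSD₃(E_M/M)`
  have hM : BSDpOver (W.baseChange M) 3 := K1 W hCM hadd hsub hr K M h2 h2' hTR he hgoodM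
  -- the Artin–Milne squeeze over `ℚ ⊂ K ⊂ M`
  haveI : (W.baseChange M).IsElliptic := by
    rw [WeierstrassCurve.baseChange]; infer_instance
  have hVM : ∃ C : WeierstrassCurve.VariableChange M, C • W.baseChange M = W.baseChange M :=
    ⟨1, one_smul _ _⟩
  exact ⟨qW, qWd, hqW, hqWd,
    padicValRat_shaAn_add_le_shaOrder_of_bsdpOver hAM W K h2 Wd hWd' M h2' hθ hθM Vβ hVβ
      (W.baseChange M) hVM 3 hWfin hWdfin (hE W) (hE Wd) hVβL hM hqβ hβfin hβup hqW hqWd⟩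

end Summit.BirchSwinnertonDyer.BirchSwinnertonDyer.Theorems.SolventPairLowerBound

end
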